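import Mathlib
import Literature.Barriers.ValiantsHypothesis.AlgebraicNaturalProofs
import Literature.Computability.AlgebraicComplexity.ArithCircuitProofs
import Literature.Computability.AlgebraicComplexity.IMMInVPProofs
import Summits.ValiantsHypothesis.ValiantsHypothesis.Theorems.BarrierLeverPartitionMinorsHitByVPSplitDoor
import Summits.ValiantsHypothesis.ValiantsHypothesis.Theorems.BarrierLeverPartitionMinorsHitByVPStrataDoorPrelims

/-!
# Route BarrierLever — item `PartitionMinorsHitByVP` (stmt-ValiantsHypothesis-19717):
# the m-STRATA DOOR with ADDITIVE size — one threshold pair, any number of strata, any matching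

Helper file (`--supports stmt-ValiantsHypothesis-19717`; cell valiant-natproofs, rung V4, 𝒟-side,
prover seat val-np-p6 gen 0). Definition-free. Closes NO item.

The general split door `…SplitDoor.partitionMinor_hit_of_split` (p442956) glues TWO threshold cells
and books the size exponent `b ↦ b + 1`; read off its proof, the witness
`C·f₁(s • x) + C·f₂` actually has size `≤ L(f₁) + L(f₂) + 2h + 3` — the composition is ADDITIVE.
This file states the additive form for ANY NUMBER `m` OF STRATA AT ONCE: one pair of weights
`λ, μ : Fin h → ℤ`, row strata `t = lv i` cut out by monotone cuts `cr` on the row values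
`v_i = Σ_{a ∈ u_i} λ_a`, column strata cut out by `cc` on `v'_j = Σ_{c ∈ w_j} μ_c`, and an
ARBITRARY injective matching `π` of row strata to column strata (column `j` lies in column
stratum `π (lv j)`, i.e. the columns are indexed so that the `t`-th row stratum faces its matched
column stratum). If stratum `t` is certified by its own polynomial `F t` (nonsingular cell matrix),
then ONE polynomial certifies the whole layout, of size `≤ Σ_t L(F t) + m·(2h + 2)` and degree
`≤ max_t deg (F t)`:
`f = Σ_t C(x₀^{G + K_t + K'_{π t}}) · (F t)(x_a ↦ x₀^{2tλ_a} x_a, y_c ↦ x₀^{2π(t)μ_c} y_c)`.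
The exponent of `x₀` in the `(i, j)` entry of summand `t` is `(K_t + 2t·v_i) + (K'_{πt} + 2π(t)·v'_j)`,
a sum of a row piece and a column piece; with `K_t = -Σ_{s<t}(2·cr(s+1)+1)` the row pieces form a
convex arrangement whose upper envelope is attained by piece `t` EXACTLY on stratum `t`
(`…StrataDoor.envelope_lt`), so the entry degree is `≤ Φ i + Ψ j` with equality iff
`t = lv i = lv j`; the leading form of `det` (`…coeff_det_eq_det_coeff`) is the block-diagonal
determinant `∏_t det(cell_t(F t)) ≠ 0` (`…det_ne_zero_of_levels`), and an evaluation point `x₀`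
off the roots of `X · det` finishes.

* **`partitionMinor_hit_of_strata`** — the door, for layouts indexed by any `Fintype ι`
  (so that a stratum, a subtype, can be fed to the door again: hierarchies compose with
  additive size, the number of LEAVES — not the depth — being what the budget `(h+h)^b` counts).

WHAT THIS IS NOT: which layouts admit poly(h)-leaf stratifications into certified cells is OPEN
(the content of item 19717 on the middle band); nothing on crux 14610 / VP vs VNP.
-/

set_option linter.dupNamespace false

namespace Summit.ValiantsHypothesis.ValiantsHypothesis.Theorems.BarrierLever.StrataDoor

open Finset
open Literature.Barriers.ValiantsHypothesis Literature.Computability.AlgebraicComplexity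
open Summit.ValiantsHypothesis.ValiantsHypothesis.Theorems.BarrierLever.ThresholdDoor (prod_ite_zpow)
open Summit.ValiantsHypothesis.ValiantsHypothesis.Theorems.BarrierLever.SplitDoor
  (coeff_rescale totalDegree_rescale_le complexity_rescale_le rescale_factor_partition)

/-- A member of a double sum of absolute values is dominated by it (nonnegativity of the shifted
exponents). -/
theorem neg_le_of_mem_sum_abs {ι : Type*} [Fintype ι] (m : ℕ) (R : ℕ → ι → ℤ) (t : ℕ)
    (ht : t < m) (i : ι) : 0 ≤ (∑ t' ∈ Finset.range m, ∑ i', |R t' i'|) + R t i := by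
  have h1 : |R t i| ≤ ∑ i', |R t i'| :=
    Finset.single_le_sum (f := fun i' => |R t i'|) (fun _ _ => abs_nonneg _) (Finset.mem_univ i)
  have h2 : (∑ i', |R t i'|) ≤ ∑ t' ∈ Finset.range m, ∑ i', |R t' i'| :=
    Finset.single_le_sum (f := fun t' => ∑ i', |R t' i'|)
      (fun _ _ => Finset.sum_nonneg fun _ _ => abs_nonneg _) (Finset.mem_range.mpr ht)
  have h3 := neg_abs_le (R t i)
  linarith

/-- **The m-strata door (additive size).** Rows and columns indexed by `ι`; row `i` lies in stratum
`lv i < m` of the row weights (`cr (lv i) < v_i ≤ cr (lv i + 1)`), column `j` lies in the column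
stratum `π (lv j)` matched to it (`cc (π (lv j)) < v'_j ≤ cc (π (lv j) + 1)`, `π` injective on
the occurring strata); if for every `t < m` the cell matrix of stratum `t` at `F t` is nonsingular, some `f` of
size `≤ Σ_{t<m} L(F t) + m(2h+2)` and degree `≤ max deg (F t)` has a nonsingular layout matrix. -/
theorem partitionMinor_hit_of_strata {ι : Type*} [Fintype ι] [DecidableEq ι] (h m : ℕ)
    (u w : ι → Finset (Fin h)) (lam mu : Fin h → ℤ) (lv : ι → ℕ) (π : ℕ → ℕ)
    (hπ : ∀ i j : ι, π (lv i) = π (lv j) → lv i = lv j) (hlv : ∀ i, lv i < m)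
    (cr cc : ℕ → ℤ) (hcr : Monotone cr) (hcc : Monotone cc)
    (hrow : ∀ i, cr (lv i) < ∑ a ∈ u i, lam a ∧ ∑ a ∈ u i, lam a ≤ cr (lv i + 1))
    (hcol : ∀ j, cc (π (lv j)) < ∑ c ∈ w j, mu c ∧ ∑ c ∈ w j, mu c ≤ cc (π (lv j) + 1))
    (F : ℕ → MvPolynomial (Fin (h + h)) ℂ)
    (hdet : ∀ t < m, (Matrix.of fun i j : {i // lv i = t} => MvPolynomial.coeff
        (∑ a ∈ u i.1, Finsupp.single (Fin.castAdd h a) 1 +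
          ∑ c ∈ w j.1, Finsupp.single (Fin.natAdd h c) 1) (F t)).det ≠ 0) :
    ∃ f : MvPolynomial (Fin (h + h)) ℂ,
      f.totalDegree ≤ (Finset.range m).sup (fun t => (F t).totalDegree) ∧
      complexity f ≤ ∑ t ∈ Finset.range m, complexity (F t) + m * (h + h + 2) ∧
      (Matrix.of fun i j : ι => MvPolynomial.coeff
        (∑ a ∈ u i, Finsupp.single (Fin.castAdd h a) 1 +
          ∑ c ∈ w j, Finsupp.single (Fin.natAdd h c) 1) f).det ≠ 0 := by
  classical
  -- functional values and envelope offsets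
  set v : ι → ℤ := fun i => ∑ a ∈ u i, lam a with hv
  set v' : ι → ℤ := fun j => ∑ c ∈ w j, mu c with hv'
  set Kr : ℕ → ℤ := fun t => -∑ s ∈ Finset.range t, (2 * cr (s + 1) + 1) with hKr
  set Kc : ℕ → ℤ := fun t => -∑ s ∈ Finset.range t, (2 * cc (s + 1) + 1) with hKc
  set R : ℕ → ι → ℤ := fun t i => Kr t + 2 * (t : ℤ) * v i with hR
  set Cx : ℕ → ι → ℤ := fun t j => Kc (π t) + 2 * ((π t : ℕ) : ℤ) * v' j with hCx
  have hR_lt : ∀ i t, t ≠ lv i → R t i < R (lv i) i := fun i t ht =>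
    envelope_lt cr hcr (v i) (lv i) (hrow i).1 (hrow i).2 t ht
  have hC_lt : ∀ j t, π t ≠ π (lv j) → Cx t j < Cx (lv j) j := fun j t ht =>
    envelope_lt cc hcc (v' j) (π (lv j)) (hcol j).1 (hcol j).2 (π t) ht
  have hR_le : ∀ i t, R t i ≤ R (lv i) i := fun i t => by
    rcases eq_or_ne t (lv i) with ht | ht
    · rw [ht]
    · exact (hR_lt i t ht).le
  have hC_le : ∀ j t, Cx t j ≤ Cx (lv j) j := fun j t => by
    rcases eq_or_ne (π t) (π (lv j)) with ht | ht
    · simp only [hCx, ht]; exact le_rfl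
    · exact (hC_lt j t ht).le
  -- nonnegative shifts
  set G₁ : ℤ := ∑ t ∈ Finset.range m, ∑ i, |R t i| with hG₁
  set G₂ : ℤ := ∑ t ∈ Finset.range m, ∑ j, |Cx t j| with hG₂
  have hG₁ge : ∀ t < m, ∀ i, 0 ≤ G₁ + R t i := fun t ht i => neg_le_of_mem_sum_abs m R t ht i
  have hG₂ge : ∀ t < m, ∀ j, 0 ≤ G₂ + Cx t j := fun t ht j => neg_le_of_mem_sum_abs m Cx t ht j
  -- natural exponents and potentials
  set D : ℕ → ι → ι → ℕ := fun t i j => (G₁ + R t i + (G₂ + Cx t j)).toNat with hD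
  set Φ : ι → ℕ := fun i => (G₁ + R (lv i) i).toNat with hΦ
  set Ψ : ι → ℕ := fun j => (G₂ + Cx (lv j) j).toNat with hΨ
  have hD_cast : ∀ t < m, ∀ i j, ((D t i j : ℕ) : ℤ) = G₁ + R t i + (G₂ + Cx t j) :=
    fun t ht i j => Int.toNat_of_nonneg (by have := hG₁ge t ht i; have := hG₂ge t ht j; linarith)
  have hΦ_cast : ∀ i, ((Φ i : ℕ) : ℤ) = G₁ + R (lv i) i := fun i =>
    Int.toNat_of_nonneg (hG₁ge _ (hlv i) i)
  have hΨ_cast : ∀ j, ((Ψ j : ℕ) : ℤ) = G₂ + Cx (lv j) j := fun j =>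
    Int.toNat_of_nonneg (hG₂ge _ (hlv j) j)
  have hD_le : ∀ t < m, ∀ i j, D t i j ≤ Φ i + Ψ j := by
    intro t ht i j
    have h1 := hR_le i t
    have h2 := hC_le j t
    have : ((D t i j : ℕ) : ℤ) ≤ (Φ i : ℤ) + (Ψ j : ℤ) := by
      rw [hD_cast t ht, hΦ_cast, hΨ_cast]; linarith
    exact_mod_cast this
  have hD_eq : ∀ t < m, ∀ i j, D t i j = Φ i + Ψ j ↔ (lv i = t ∧ lv j = t) := by
    intro t ht i j
    constructor
    · intro hh
      have hz : G₁ + R t i + (G₂ + Cx t j) = (G₁ + R (lv i) i) + (G₂ + Cx (lv j) j) := by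
        have := congrArg (Nat.cast : ℕ → ℤ) hh
        push_cast at this
        rwa [hD_cast t ht, hΦ_cast, hΨ_cast] at this
      have h1 : t = lv i := by
        by_contra hne
        have := hR_lt i t hne
        have := hC_le j t
        linarith
      have h2 : π t = π (lv j) := by
        by_contra hne
        have := hC_lt j t hne
        have := hR_le i t
        linarith
      have h3 : lv i = lv j := hπ i j (by rw [← h1]; exact h2)
      exact ⟨h1.symm, by rw [← h3]; exact h1.symm⟩
    · rintro ⟨h1, h2⟩
      have : ((D t i j : ℕ) : ℤ) = (Φ i : ℤ) + (Ψ j : ℤ) := by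
        rw [hD_cast t ht, hΦ_cast, hΨ_cast, h1, h2]
      exact_mod_cast this
  -- coefficient matrices of the strata witnesses and the polynomial matrix
  set p : ℕ → Matrix ι ι ℂ := fun t => Matrix.of fun i j => MvPolynomial.coeff
    (∑ a ∈ u i, Finsupp.single (Fin.castAdd h a) 1 + ∑ c ∈ w j, Finsupp.single (Fin.natAdd h c) 1)
    (F t) with hp
  set A : Matrix ι ι (Polynomial ℂ) := Matrix.of fun i j =>
    ∑ t ∈ Finset.range m, Polynomial.C (p t i j) * Polynomial.X ^ D t i j with hA
  have hAdeg : ∀ i j, (A i j).natDegree ≤ Φ i + Ψ j := by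
    intro i j
    simp only [hA, Matrix.of_apply]
    refine Polynomial.natDegree_sum_le_of_forall_le _ _ fun t ht => ?_
    exact (Polynomial.natDegree_C_mul_X_pow_le _ _).trans (hD_le t (Finset.mem_range.mp ht) i j)
  have hAcoeff : ∀ i j, (A i j).coeff (Φ i + Ψ j) = if lv i = lv j then p (lv i) i j else 0 := by
    intro i j
    simp only [hA, Matrix.of_apply]
    rw [Polynomial.finsetSum_coeff]
    simp_rw [Polynomial.coeff_C_mul_X_pow]
    by_cases hij : lv i = lv j
    · rw [if_pos hij, Finset.sum_eq_single (lv i)]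
      · rw [if_pos ((hD_eq _ (hlv i) i j).mpr ⟨rfl, hij.symm⟩).symm]
      · intro t ht hne
        rw [if_neg]
        intro hh
        exact hne ((hD_eq t (Finset.mem_range.mp ht) i j).mp hh.symm).1.symm
      · intro hh
        exact absurd (Finset.mem_range.mpr (hlv i)) hh
    · rw [if_neg hij]
      refine Finset.sum_eq_zero fun t ht => ?_
      rw [if_neg]
      intro hh
      obtain ⟨h1, h2⟩ := (hD_eq t (Finset.mem_range.mp ht) i j).mp hh.symm
      exact hij (h1.trans h2.symm)
  -- the leading form is block diagonal with the cell matrices as blocks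
  set B : Matrix ι ι ℂ := Matrix.of fun i j => (A i j).coeff (Φ i + Ψ j) with hB
  have hBdet : B.det ≠ 0 := by
    refine det_ne_zero_of_levels B lv (fun i j hij => by
      simp only [hB, Matrix.of_apply, hAcoeff, if_neg hij]) (fun t ht => ?_)
    obtain ⟨i₀, -, hi₀⟩ := Finset.mem_image.mp ht
    have htm : t < m := hi₀ ▸ hlv i₀
    have hblk : (Matrix.of fun i j : {i // lv i = t} => B i.1 j.1) =
        Matrix.of fun i j : {i // lv i = t} => MvPolynomial.coeff
          (∑ a ∈ u i.1, Finsupp.single (Fin.castAdd h a) 1 +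
            ∑ c ∈ w j.1, Finsupp.single (Fin.natAdd h c) 1) (F t) := by
      ext i j
      simp only [hB, Matrix.of_apply, hAcoeff, i.2, j.2, if_true, hp]
    rw [hblk]
    exact hdet t htm
  have hdetA : A.det ≠ 0 := by
    intro h0
    apply hBdet
    have := coeff_det_eq_det_coeff A Φ Ψ hAdeg
    rw [h0, Polynomial.coeff_zero] at this
    exact this.symm
  -- evaluation point off the roots of `X · det A`
  have hXD : (Polynomial.X * A.det) ≠ 0 := mul_ne_zero Polynomial.X_ne_zero hdetA
  obtain ⟨x₀, hx₀⟩ := Infinite.exists_notMem_finset (Polynomial.X * A.det).roots.toFinset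
  rw [Multiset.mem_toFinset, Polynomial.mem_roots hXD, Polynomial.IsRoot.def, Polynomial.eval_mul,
    Polynomial.eval_X, mul_eq_zero, not_or] at hx₀
  obtain ⟨hx₀ne, hdetx⟩ := hx₀
  have hevaldet : Polynomial.eval x₀ A.det =
      (Matrix.of fun i j : ι => ∑ t ∈ Finset.range m, p t i j * x₀ ^ D t i j).det := by
    rw [← Polynomial.coe_evalRingHom, RingHom.map_det]
    congr 1
    ext i j
    simp [hA, RingHom.mapMatrix_apply, Matrix.map_apply, Polynomial.eval_finsetSum]
  -- the witness
  set s : ℕ → Fin (h + h) → ℂ := fun t i => Fin.addCases (fun a => x₀ ^ (2 * (t : ℤ) * lam a))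
    (fun c => x₀ ^ (2 * ((π t : ℕ) : ℤ) * mu c)) i with hs
  have hs_cast : ∀ t (a : Fin h), s t (Fin.castAdd h a) = x₀ ^ (2 * (t : ℤ) * lam a) := fun t a =>
    Fin.addCases_left _
  have hs_nat : ∀ t (c : Fin h), s t (Fin.natAdd h c) = x₀ ^ (2 * ((π t : ℕ) : ℤ) * mu c) :=
    fun t c => Fin.addCases_right _
  set g : ℕ → MvPolynomial (Fin (h + h)) ℂ := fun t => ∑ dd ∈ (F t).support, MvPolynomial.monomial dd
      (MvPolynomial.coeff dd (F t) * ∏ i ∈ dd.support, s t i ^ dd i) with hg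
  set f : MvPolynomial (Fin (h + h)) ℂ :=
    ∑ t ∈ Finset.range m, MvPolynomial.C (x₀ ^ (G₁ + G₂ + Kr t + Kc (π t))) * g t with hf
  refine ⟨f, ?_, ?_, ?_⟩
  · -- degree
    refine (MvPolynomial.totalDegree_finsetSum _ _).trans (Finset.sup_mono_fun fun t _ => ?_)
    refine (MvPolynomial.totalDegree_mul _ _).trans ?_
    rw [MvPolynomial.totalDegree_C, zero_add]
    exact totalDegree_rescale_le (s t) (F t)
  · -- size
    calc complexity f
        ≤ ∑ t ∈ Finset.range m, complexity (MvPolynomial.C (x₀ ^ (G₁ + G₂ + Kr t + Kc (π t))) * g t) +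
            (Finset.range m).card := complexity_finset_sum_le _ _
      _ ≤ ∑ t ∈ Finset.range m, (complexity (F t) + (h + h) + 1) + (Finset.range m).card := by
          gcongr with t ht
          calc _ ≤ complexity (MvPolynomial.C (x₀ ^ (G₁ + G₂ + Kr t + Kc (π t))) :
                  MvPolynomial (Fin (h + h)) ℂ) + complexity (g t) + 1 := complexity_mul_le_holds _ _
            _ ≤ 0 + (complexity (F t) + (h + h)) + 1 := by
                gcongr
                · exact (complexity_C_holds _).le
                · exact complexity_rescale_le (s t) (F t)
            _ = _ := by ring
      _ = ∑ t ∈ Finset.range m, complexity (F t) + m * (h + h + 2) := by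
          rw [Finset.sum_add_distrib, Finset.sum_add_distrib, Finset.sum_const, Finset.sum_const,
            Finset.card_range, smul_eq_mul, smul_eq_mul]
          ring
  · -- the layout matrix of `f` is the evaluated polynomial matrix
    have hcoef : ∀ i j : ι, MvPolynomial.coeff
        (∑ a ∈ u i, Finsupp.single (Fin.castAdd h a) 1 + ∑ c ∈ w j, Finsupp.single (Fin.natAdd h c) 1)
        f = ∑ t ∈ Finset.range m, p t i j * x₀ ^ D t i j := by
      intro i j
      rw [hf, MvPolynomial.coeff_sum]
      refine Finset.sum_congr rfl fun t ht => ?_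
      have htm : t < m := Finset.mem_range.mp ht
      rw [MvPolynomial.coeff_C_mul, hg, coeff_rescale, rescale_factor_partition]
      simp_rw [hs_cast, hs_nat]
      rw [prod_ite_zpow x₀ hx₀ne, prod_ite_zpow x₀ hx₀ne]
      have hpij : p t i j = MvPolynomial.coeff
          (∑ a ∈ u i, Finsupp.single (Fin.castAdd h a) 1 + ∑ c ∈ w j, Finsupp.single (Fin.natAdd h c) 1)
          (F t) := rfl
      rw [hpij]
      have hpow : x₀ ^ (G₁ + G₂ + Kr t + Kc (π t)) *
          (x₀ ^ (∑ a ∈ u i, 2 * (t : ℤ) * lam a) * x₀ ^ (∑ c ∈ w j, 2 * ((π t : ℕ) : ℤ) * mu c)) =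
          x₀ ^ (D t i j) := by
        rw [← zpow_natCast, hD_cast t htm, ← zpow_add₀ hx₀ne, ← zpow_add₀ hx₀ne]
        congr 1
        simp only [hR, hCx, hv, hv', Finset.mul_sum]
        ring
      rw [← hpow]
      ring
    have hM : (Matrix.of fun i j : ι => MvPolynomial.coeff
        (∑ a ∈ u i, Finsupp.single (Fin.castAdd h a) 1 + ∑ c ∈ w j, Finsupp.single (Fin.natAdd h c) 1)
        f) = Matrix.of fun i j : ι => ∑ t ∈ Finset.range m, p t i j * x₀ ^ D t i j := by
      ext i j
      rw [Matrix.of_apply, Matrix.of_apply, hcoef]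
    rw [hM, ← hevaldet]
    exact hdetx

end Summit.ValiantsHypothesis.ValiantsHypothesis.Theorems.BarrierLever.StrataDoor
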